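import Summits.AtomisticToContinuum.HydrodynamicLimit.Theses.ImplosionDichotomy
import Summits.AtomisticToContinuum.HydrodynamicLimit.Theorems.DenseExcursion.Negative.Dichotomy
import Summits.AtomisticToContinuum.HydrodynamicLimit.Theorems.PolynomialCompression.Negative.Statics
import Summits.AtomisticToContinuum.HydrodynamicLimit.Theorems.OneFlightGossipEngineUniformLocalGibbsConcentration
import Summits.AtomisticToContinuum.HydrodynamicLimit.Theorems.ImplosionDichotomyPolynomialCompressionStaticsSmoothRate
import Summits.AtomisticToContinuum.HydrodynamicLimit.Theorems.ImplosionDichotomyHsEosLowDensity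
import Literature.MathematicalPhysics.KineticTheory.HardSphereEulerLocalExistence
import Literature.Analysis.FunctionSpaces.TorusMollifier

/-!
# `DiluteSelfConsistency`: the threshold `σ₀` cannot be uniform in the profiles (negative lemma, stmt-3091)

Negative knowledge for the crux `ImplosionDichotomy.DiluteSelfConsistency` (stmt-AtomisticToContinuum-3091), from the
standing disprover's work file `Cruxes/DiluteSelfConsistency/Disproof.lean`
(refuter-cdisprove-stmt-AtomisticToContinuum-3091-0).

The crux reads `∀ η > 0, ∀ profiles, ∃ σ₀ > 0, ∀ σ < σ₀, …`; the natural strengthening with the threshold chosen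
BEFORE the profiles, `DiluteSelfConsistencyProfileUniform : ∀ η > 0, ∃ σ₀ > 0, ∀ profiles, ∀ σ < σ₀, …`, is FALSE
(`not_diluteSelfConsistencyProfileUniform`), and it is false ALREADY AT `t = 0`, with NO implosion: a tall
activity peak `a = 1 + (standard mollifier of width ε)` makes the pinned initial density
`rhoLim (profileOf a) σ = a/∫a + O(σ³M²)` reach packing `≥ (3/4)·M σ³` at the peak, `M = sup a/∫a ≍ ε⁻³`, while the
low-density statics still apply because only the product `M σ³` enters them. Concretely, with
`λ* = min (1/(64e²)) ((4/5) v₁ η₁)` (`v₁` = volume of the unit ball, `η₁` = the packing threshold of the PROVED local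
existence theorem `hsEuler_localExistence_holds` for the PROVED analytic equation of state `hsEosLowDensity_proof`)
and the level `η* = λ*/(2v₁)`: for every `σ₀ > 0` choose `ε` so small that `M ≥ λ*/(v₁ (σ₀/2)³)` and put
`σ³ := λ*/(v₁ M) < σ₀³`; then `e·2Mv₁σ³ = 2eλ* ≤ 1/32` is the uniform smallness of the landed η₀-uniform statics
(`UniformLGC.localGibbsMeasure_density_le / _momentum_le / _energy_le`, stmt-14445 PROVED), the pinned density is
smooth (`stub_staticsSmoothRate`), positive, with packing in `[3λ*/(4v₁), 5λ*/(4v₁)] ⊆ [η*, η₁]`, so a classical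
solution EXISTS from it (local existence), is ADMISSIBLE (tie at `t = 0` through Alexander's flows), and violates
the bound `< η*` at `t = 0`.

So any proof of the crux must let `σ₀` shrink with the activity profile — quantitatively `M_P · σ₀(η, P)³ ≲ η`
is forced by the equilibrium statics alone (cf. the landed `not_denseExcursionAtTimeZero`: for FIXED profiles the
initial packing is `O(σ³)`, which is why the crux itself is decided only dynamically, at the `DenseExcursion` heart).
By-products, importable: `tendstoHydroFieldsAt_zero_of_small` (the `t = 0` tie under the EXPLICIT uniform smallness
`e·2Mv₁σ³ ≤ 1/32`, no profile-dependent threshold) and `exists_admissible_of_small` (EXISTENCE of an admissible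
classical solution from any smooth positive activity under explicit smallness — the first certified admissible
solutions with non-constant density).
-/

noncomputable section

namespace Summit.AtomisticToContinuum.HydrodynamicLimit.Theorems

open MeasureTheory Filter Set Topology Metric
open scoped ENNReal
open Literature.MathematicalPhysics.KineticTheory Literature.Analysis.FluidPDE
open Literature.Analysis.FunctionSpaces
open Summit.AtomisticToContinuum.HydrodynamicLimit.Theses.ImplosionDichotomy

/-- `DiluteSelfConsistency` with the threshold chosen BEFORE the profiles: `∀ η > 0, ∃ σ₀ > 0, ∀ profiles` (all
else verbatim). -/
def DiluteSelfConsistencyProfileUniform : Prop :=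
  ∀ η : ℝ, 0 < η → ∃ σ₀ : ℝ, 0 < σ₀ ∧ ∀ (a₀ θ₀ : T3 → ℝ) (u₀ : T3 → V3), Continuous a₀ → Continuous θ₀ →
    Continuous u₀ → (∀ x, 0 < a₀ x) → (∀ x, 0 < θ₀ x) → ∀ σ : ℝ, 0 < σ → σ < σ₀ →
      ∀ (T : ℝ) (ρ θ : ℝ → T3 → ℝ) (u : ℝ → T3 → V3), IsHardSphereEulerSolution σ T ρ u θ →
        ∀ Φ : (N : ℕ) → HardSphereFlow (Torus.geometry (Fin 3)) (hsDiameter σ N) (N + 1),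
          TendstoHydroFieldsAt (fun N => localGibbsLaw σ a₀ u₀ θ₀ N (Φ N)) Φ ρ u θ 0 →
            ∀ t ∈ Ico 0 T, ∀ x, ρ t x * σ ^ 3 < η

namespace DiluteSelfConsistencyProfileUniformNeg

/-! ## The `t = 0` tie under EXPLICIT uniform smallness -/

/-- A sequence in `ℝ≥0∞` dominated by `K e^{-(N+1)/K}` tends to `0` (the rate bookkeeping of the η₀-uniform
statics, cf. `LGFS.tendsto_ofReal_Kexp`). [folklore] -/
theorem tendsto_of_le_Kexp {f : ℕ → ℝ≥0∞} {K : ℝ} (hK : 0 < K)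
    (h : ∀ N, f N ≤ ENNReal.ofReal (K * Real.exp (-(K⁻¹ * ((N : ℝ) + 1))))) : Tendsto f atTop (𝓝 0) := by
  have h1 : Tendsto (fun N : ℕ => K⁻¹ * ((N : ℝ) + 1)) atTop atTop :=
    Tendsto.const_mul_atTop (inv_pos.2 hK) (tendsto_atTop_add_const_right _ _ tendsto_natCast_atTop_atTop)
  have h2 : Tendsto (fun N : ℕ => Real.exp (-(K⁻¹ * ((N : ℝ) + 1)))) atTop (𝓝 0) :=
    Real.tendsto_exp_atBot.comp (tendsto_neg_atTop_atBot.comp h1)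
  have h3 := (h2.const_mul K)
  rw [mul_zero] at h3
  have h4 := ENNReal.tendsto_ofReal h3
  rw [ENNReal.ofReal_zero] at h4
  exact tendsto_of_tendsto_of_tendsto_of_le_of_le tendsto_const_nhds h4 (fun _ => bot_le) h

/-- **The `t = 0` tie under EXPLICIT uniform smallness.** For continuous profiles `a₀, θ₀ > 0`, `u₀` and
`0 < σ < 1/2` with `e · 2 M v₁ σ³ ≤ 1/32` (`M = sup a₀/∫a₀`; NO profile-dependent threshold), every field triple
whose time-`0` slices are `(rhoLim (profileOf a₀) σ, u₀, θ₀)` is tied at `t = 0` to the local Gibbs laws through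
every flow family (η₀-uniform exponential statics `UniformLGC.localGibbsMeasure_*_le`, stmt-14445, and
`Φ_0 = id` a.e.). [folklore] -/
theorem tendstoHydroFieldsAt_zero_of_small {a₀ θ₀ : T3 → ℝ} {u₀ : T3 → V3} (ha : Continuous a₀)
    (hθ : Continuous θ₀) (hu : Continuous u₀) (ha0 : ∀ x, 0 < a₀ x) (hθ0 : ∀ x, 0 < θ₀ x) {σ : ℝ}
    (hσ : 0 < σ) (hσ2 : σ < 1 / 2)
    (hsmall : Real.exp 1 * (2 * (profileOf a₀ ha ha0).M * v₁ * σ ^ 3) ≤ 1 / 32)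
    (Φ : (N : ℕ) → HardSphereFlow (Torus.geometry (Fin 3)) (hsDiameter σ N) (N + 1))
    {ρ θ : ℝ → T3 → ℝ} {u : ℝ → T3 → V3} (hρ0 : ρ 0 = rhoLim (profileOf a₀ ha ha0) σ) (hu0 : u 0 = u₀)
    (hθ0' : θ 0 = θ₀) :
    TendstoHydroFieldsAt (fun N => localGibbsLaw σ a₀ u₀ θ₀ N (Φ N)) Φ ρ u θ 0 := by
  intro χ hχ δ hδ
  obtain ⟨K₁, hK₁, h₁⟩ := UniformLGC.localGibbsMeasure_density_le (u₀ := u₀) ha hθ hu ha0 hθ0 hσ hσ2 hsmall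
    hχ hδ
  obtain ⟨K₂, hK₂, h₂⟩ := UniformLGC.localGibbsMeasure_momentum_le ha hθ hu ha0 hθ0 hσ hσ2 hsmall hχ hδ
  obtain ⟨K₃, hK₃, h₃⟩ := UniformLGC.localGibbsMeasure_energy_le ha hθ hu ha0 hθ0 hσ hσ2 hsmall hχ hδ
  rw [hρ0, hu0, hθ0']
  refine ⟨tendsto_of_le_Kexp hK₁ fun N => ?_, tendsto_of_le_Kexp hK₂ fun N => ?_,
    tendsto_of_le_Kexp hK₃ fun N => ?_⟩
  · refine le_trans (le_of_eq ?_) (h₁ N)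
    rw [← localGibbsLaw_preimage_flow_zero σ a₀ u₀ θ₀ N (Φ N)]
    congr 1
    ext z
    simp only [Set.mem_setOf_eq, Set.mem_preimage, empiricalDensityField_eq_sum]
  · refine le_trans (le_of_eq ?_) (h₂ N)
    rw [← localGibbsLaw_preimage_flow_zero σ a₀ u₀ θ₀ N (Φ N)]
    rfl
  · refine le_trans (le_of_eq ?_) (h₃ N)
    rw [← localGibbsLaw_preimage_flow_zero σ a₀ u₀ θ₀ N (Φ N)]
    rfl

/-- **EXISTENCE OF ADMISSIBLE CLASSICAL SOLUTIONS under explicit smallness.** Let `η₁` be a packing threshold of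
local classical existence for the analytic equation of state (as produced by `hsEuler_localExistence_holds` on
`hsEosLowDensity_proof`). For a SMOOTH positive activity `a₀`, smooth `θ₀ > 0`, `u₀`, and `0 < σ < 1/2` with the
uniform smallness `e·2Mv₁σ³ ≤ 1/32` and pinned packing `rhoLim (profileOf a₀) σ · σ³ ≤ η₁`, there is an ADMISSIBLE
classical hard-sphere-Euler solution on some `[0,T)`, `T > 0`, with data `(rhoLim (profileOf a₀) σ, u₀, θ₀)` (pinned
density smooth by `stub_staticsSmoothRate`, positive by `rhoLim_pos_of_geomRatio_le`; flows by Alexander).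
[folklore] -/
theorem exists_admissible_of_small {η₀ : ℝ} (hη₀ : 0 < η₀) {F : ℝ → ℝ} (hFa : AnalyticOnNhd ℝ F (Ioo (-η₀) η₀))
    (hFeq : EqOn hsExcessFreeEnergy F (Ico 0 η₀)) :
    ∃ η₁ : ℝ, 0 < η₁ ∧ ∀ {a₀ θ₀ : T3 → ℝ} {u₀ : T3 → V3} (ha : Torus.IsSmooth a₀) (hθ : Torus.IsSmooth θ₀)
      (hu : Torus.IsSmooth u₀) (ha0 : ∀ x, 0 < a₀ x) (hθ0 : ∀ x, 0 < θ₀ x) {σ : ℝ} (hσ : 0 < σ) (hσ2 : σ < 1 / 2),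
      Real.exp 1 * (2 * (profileOf a₀ ha.continuous ha0).M * v₁ * σ ^ 3) ≤ 1 / 32 →
      (∀ x, rhoLim (profileOf a₀ ha.continuous ha0) σ x * σ ^ 3 ≤ η₁) →
      ∃ T : ℝ, 0 < T ∧ ∃ (ρ θ : ℝ → T3 → ℝ) (u : ℝ → T3 → V3), IsHardSphereEulerSolution σ T ρ u θ ∧
        ρ 0 = rhoLim (profileOf a₀ ha.continuous ha0) σ ∧ u 0 = u₀ ∧ θ 0 = θ₀ ∧
        Nonempty ((N : ℕ) → HardSphereFlow (Torus.geometry (Fin 3)) (hsDiameter σ N) (N + 1)) ∧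
          ∀ Ψ : (N : ℕ) → HardSphereFlow (Torus.geometry (Fin 3)) (hsDiameter σ N) (N + 1),
            TendstoHydroFieldsAt (fun N => localGibbsLaw σ a₀ u₀ θ₀ N (Ψ N)) Ψ ρ u θ 0 := by
  obtain ⟨η₁, hη₁, LE⟩ := hsEuler_localExistence_holds η₀ hη₀ F hFa hFeq
  refine ⟨η₁, hη₁, ?_⟩
  intro a₀ θ₀ u₀ ha hθ hu ha0 hθ0 σ hσ hσ2 hsmall hpack
  set P := profileOf a₀ ha.continuous ha0 with hP
  have hPs : SmallDensity P σ :=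
    UniformLGC.smallDensity_of_eta_le (Mstar := 2 * P.M) hσ hσ2 (by linarith [P.M_pos]) hsmall
  have hθP : geomRatio P σ ≤ 1 / 16 := by
    rw [geomRatio, ovDensity]
    calc 2 * Real.exp 1 * (P.M * v₁ * σ ^ 3) = Real.exp 1 * (2 * P.M * v₁ * σ ^ 3) := by ring
      _ ≤ 1 / 16 := hsmall.trans (by norm_num)
  have hpos : ∀ x, 0 < rhoLim P σ x := fun x => UniformLGC.rhoLim_pos_of_geomRatio_le hPs hθP x
  have hsm : Torus.IsSmooth (rhoLim P σ) := (stub_staticsSmoothRate a₀ ha ha0).1 σ hPs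
  obtain ⟨T, hT, ρ, θ, u, hE, hρ0, hu0, hθ0'⟩ := LE σ hσ (rhoLim P σ) θ₀ u₀ hsm hθ hu hpos hθ0 hpack
  exact ⟨T, hT, ρ, θ, u, hE, hρ0, hu0, hθ0', DenseExcursionDichotomy.flows_nonempty hσ hσ2, fun Ψ =>
    tendstoHydroFieldsAt_zero_of_small ha.continuous hθ.continuous hu.continuous ha0 hθ0 hσ hσ2 hsmall Ψ
      hρ0 hu0 hθ0'⟩

/-! ## Tall activity peaks: `1 +` the standard mollifier of width `ε` -/

/-- The peaked activity `a_ε = 1 + kernel ε` (`kernel ε` the standard unit-mass mollifier on `𝕋³` of width `ε`).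
[folklore] -/
def peak (ε : ℝ) (x : T3) : ℝ := 1 + Torus.kernel ε x

/-- `a_ε` is smooth for `0 < ε ≤ 1/4`. [folklore] -/
theorem isSmooth_peak {ε : ℝ} (hε : 0 < ε) (hε' : ε ≤ 1 / 4) : Torus.IsSmooth (peak ε) :=
  (Torus.isSmooth_const (1 : ℝ)).add (Torus.isSmooth_kernel hε hε')

/-- `a_ε > 0` (the mollifier is nonnegative). [folklore] -/
theorem peak_pos {ε : ℝ} (hε : 0 ≤ ε) (x : T3) : 0 < peak ε x := by
  have := Torus.kernel_nonneg (d := Fin 3) hε x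
  unfold peak
  linarith

/-- `a_ε ≥ 1`. [folklore] -/
theorem one_le_peak {ε : ℝ} (hε : 0 ≤ ε) (x : T3) : 1 ≤ peak ε x := by
  have := Torus.kernel_nonneg (d := Fin 3) hε x
  unfold peak
  linarith

/-- `∫ a_ε = 2` (`𝕋³` has volume `1`, the mollifier has unit mass). [folklore] -/
theorem integral_peak {ε : ℝ} (hε : 0 < ε) (hε' : ε ≤ 1 / 4) : ∫ x, peak ε x = 2 := by
  unfold peak
  rw [integral_add (integrable_const _) (Torus.continuous_kernel hε hε').integrable_unitAddTorus,
    Torus.integral_kernel hε hε', integral_const]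
  simp only [smul_eq_mul]
  norm_num

/-- The height constant `c₀ = ρ₁(0) > 0` of the unit-mass profile. [folklore] -/
theorem profileOne_zero_pos : 0 < Torus.profileOne (Fin 3) 0 := by
  unfold Torus.profileOne
  rw [ContDiffBump.normed_def]
  refine div_pos ?_ (ContDiffBump.integral_pos _)
  rw [ContDiffBump.one_of_mem_closedBall]
  · exact one_pos
  · exact mem_closedBall_self (by simp only [Torus.bumpOne]; norm_num)

/-- The mollifier's height at the origin: `kernel ε 0 = ε⁻³ ρ₁(0)`. [folklore] -/
theorem kernel_zero_eq {ε : ℝ} : Torus.kernel ε (0 : T3) = (ε ^ 3)⁻¹ * Torus.profileOne (Fin 3) 0 := by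
  have h0 : Torus.reprc (0 : T3) = 0 := by
    have h := Torus.reprc_proj_of_norm_lt (d := Fin 3) (v := 0) (by rw [norm_zero]; norm_num)
    rwa [Torus.proj_zero] at h
  unfold Torus.kernel
  rw [Torus.transplant_apply, h0]
  unfold Torus.profile
  simp only [smul_zero, Fintype.card_fin]

/-- **The normalised peak is tall**: `M(a_ε/∫a_ε) ≥ c₀/(2ε³)`. [folklore] -/
theorem le_M_peak {ε : ℝ} (hε : 0 < ε) (hε' : ε ≤ 1 / 4) :
    Torus.profileOne (Fin 3) 0 / (2 * ε ^ 3) ≤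
      (profileOf (peak ε) (isSmooth_peak hε hε').continuous (peak_pos hε.le)).M := by
  set P := profileOf (peak ε) (isSmooth_peak hε hε').continuous (peak_pos hε.le) with hP
  refine le_trans ?_ (P.le_M 0)
  rw [hP, profileOf_β, integral_peak hε hε']
  unfold peak
  rw [kernel_zero_eq]
  have hε3 : 0 < ε ^ 3 := pow_pos hε 3
  have hc := profileOne_zero_pos
  rw [div_le_div_iff₀ (by positivity) (by norm_num : (0 : ℝ) < 2)]
  have : Torus.profileOne (Fin 3) 0 * 2 = ((ε ^ 3)⁻¹ * Torus.profileOne (Fin 3) 0) * (2 * ε ^ 3) := by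
    field_simp
  rw [this]
  refine mul_le_mul_of_nonneg_right ?_ (by positivity)
  have : 0 ≤ (ε ^ 3)⁻¹ * Torus.profileOne (Fin 3) 0 := by positivity
  linarith

/-! ## Choices of the width, the reduced diameter, and the two numeric consequences -/

/-- Choice of the peak width: for every height `K` there is `0 < ε ≤ 1/4` with `K ≤ M(a_ε/∫a_ε)`. [folklore] -/
theorem exists_peak_M_ge (K : ℝ) : ∃ ε : ℝ, ∃ hε : 0 < ε, ∃ hε' : ε ≤ 1 / 4,
    K ≤ (profileOf (peak ε) (isSmooth_peak hε hε').continuous (peak_pos hε.le)).M := by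
  set c₀ : ℝ := Torus.profileOne (Fin 3) 0 with hc₀
  have hc₀0 : 0 < c₀ := profileOne_zero_pos
  set K' : ℝ := max K 1 with hK'
  have hK'0 : 0 < K' := one_pos.trans_le (le_max_right _ _)
  set q : ℝ := c₀ / (2 * K') with hq
  have hq0 : 0 < q := by positivity
  set ε : ℝ := min (1 / 4) (q ^ ((3 : ℕ) : ℝ)⁻¹) with hεdef
  have hε0 : 0 < ε := lt_min (by norm_num) (Real.rpow_pos_of_pos hq0 _)
  have hε4 : ε ≤ 1 / 4 := min_le_left _ _
  have hε3q : ε ^ 3 ≤ q := by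
    have h1 : ε ≤ q ^ ((3 : ℕ) : ℝ)⁻¹ := min_le_right _ _
    have h2 : ε ^ 3 ≤ (q ^ ((3 : ℕ) : ℝ)⁻¹) ^ 3 := pow_le_pow_left₀ hε0.le h1 3
    rwa [Real.rpow_inv_natCast_pow hq0.le (by norm_num)] at h2
  refine ⟨ε, hε0, hε4, (le_max_left K 1).trans (le_trans ?_ (le_M_peak hε0 hε4))⟩
  rw [le_div_iff₀ (by positivity)]
  have h := (le_div_iff₀ (by positivity : (0 : ℝ) < 2 * K')).1 (hq ▸ hε3q)
  calc K' * (2 * ε ^ 3) = ε ^ 3 * (2 * K') := by ring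
    _ ≤ c₀ := h

/-- Choice of the reduced diameter: `M v σ³ = λ` with `σ ≤ s` as soon as `λ/(v s³) ≤ M`. [folklore] -/
theorem exists_sigma {lam v M s : ℝ} (hlam : 0 < lam) (hv : 0 < v) (hM : 0 < M) (hs : 0 < s)
    (hKM : lam / (v * s ^ 3) ≤ M) : ∃ σ : ℝ, 0 < σ ∧ σ ≤ s ∧ M * v * σ ^ 3 = lam := by
  have hσ : 0 < (lam / (v * M)) ^ ((3 : ℕ) : ℝ)⁻¹ := Real.rpow_pos_of_pos (by positivity) _
  have hσ3 : ((lam / (v * M)) ^ ((3 : ℕ) : ℝ)⁻¹) ^ 3 = lam / (v * M) :=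
    Real.rpow_inv_natCast_pow (by positivity) (by norm_num)
  refine ⟨(lam / (v * M)) ^ ((3 : ℕ) : ℝ)⁻¹, hσ, ?_, ?_⟩
  · refine le_of_pow_le_pow_left₀ (by norm_num : (3 : ℕ) ≠ 0) hs.le ?_
    rw [hσ3, div_le_iff₀ (by positivity)]
    rw [div_le_iff₀ (by positivity)] at hKM
    calc lam ≤ M * (v * s ^ 3) := hKM
      _ = s ^ 3 * (v * M) := by ring
  · rw [hσ3]
    field_simp

/-- The two numeric consequences of `M v σ³ = λ` with `λ · 64e² ≤ 1`: the uniform smallness `e·2Mvσ³ ≤ 1/32` and the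
statics error `16e²vM²σ³ ≤ M/4`. [folklore] -/
theorem numerics {M v σ lam : ℝ} (hM : 0 < M) (hlam0 : 0 ≤ lam) (hMvσ : M * v * σ ^ 3 = lam)
    (hlam1 : lam * (64 * Real.exp 1 ^ 2) ≤ 1) :
    Real.exp 1 * (2 * M * v * σ ^ 3) ≤ 1 / 32 ∧ 16 * Real.exp 1 ^ 2 * v * M ^ 2 * σ ^ 3 ≤ M / 4 := by
  set e : ℝ := Real.exp 1 with he
  have he1 : 1 ≤ e := by have := Real.add_one_le_exp (1 : ℝ); rw [he]; linarith
  have hee : e ≤ e ^ 2 := by nlinarith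
  constructor
  · have h1 : e * (2 * M * v * σ ^ 3) = 2 * e * lam := by rw [← hMvσ]; ring
    rw [h1]
    calc 2 * e * lam ≤ 2 * e ^ 2 * lam := by nlinarith [mul_le_mul_of_nonneg_right hee hlam0]
      _ = lam * (64 * e ^ 2) / 32 := by ring
      _ ≤ 1 / 32 := by linarith
  · have h1 : 16 * e ^ 2 * v * M ^ 2 * σ ^ 3 = lam * (64 * e ^ 2) / 4 * M := by rw [← hMvσ]; ring
    rw [h1]
    calc lam * (64 * e ^ 2) / 4 * M ≤ 1 / 4 * M := mul_le_mul_of_nonneg_right (by linarith) hM.le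
      _ = M / 4 := by ring

end DiluteSelfConsistencyProfileUniformNeg

open DiluteSelfConsistencyProfileUniformNeg

/-- **`σ₀` CANNOT BE UNIFORM IN THE PROFILES** (`¬ DiluteSelfConsistencyProfileUniform`): at the fixed level
`η* = λ*/(2v₁)`, for every threshold `σ₀` there are a smooth peaked activity `a_ε = 1 + kernel ε`
(`M = sup a_ε/∫a_ε ≥ c₀/(2ε³)` large), `θ₀ ≡ 1`, `u₀ ≡ 0`, a reduced diameter `σ < σ₀` with `M v₁ σ³ = λ*`, and an
ADMISSIBLE classical solution whose packing at `t = 0` at the activity maximum is already `≥ (3/4)λ*/v₁ > η*`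
(pinned density `rhoLim = a/∫a ± 16e²v₁M²σ³ = M(1 ± 1/4)` at the peak, `PolynomialCompressionStatics.abs_rhoLim_sub_β_le`),
while every hypothesis of the η₀-uniform statics and of local classical existence holds because only `Mσ³` enters
them. So any proof of the crux must let `σ₀` depend on the activity profile, with `M_P σ₀³ = O(η)`. [folklore] -/
theorem not_diluteSelfConsistencyProfileUniform : ¬ DiluteSelfConsistencyProfileUniform := by
  intro hU
  -- equation of state, local existence and admissibility under explicit smallness
  obtain ⟨η₀, hη₀, F, hFa, hFeq, -⟩ := hsEosLowDensity_proof
  obtain ⟨η₁, hη₁, ADM⟩ := exists_admissible_of_small hη₀ hFa hFeq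
  have he0 : 0 < Real.exp 1 := Real.exp_pos 1
  have hv : 0 < v₁ := v₁_pos
  -- the scale `λ*` and the level `η* = λ*/(2v₁)`
  set lam : ℝ := min (1 / (64 * Real.exp 1 ^ 2)) (4 / 5 * v₁ * η₁) with hlam
  have hlam0 : 0 < lam := lt_min (by positivity) (by positivity)
  have hlam1 : lam * (64 * Real.exp 1 ^ 2) ≤ 1 := by
    rw [← le_div_iff₀ (by positivity)]
    exact min_le_left _ _
  have hlam2 : lam ≤ 4 / 5 * v₁ * η₁ := min_le_right _ _
  obtain ⟨σ₀, hσ₀, D⟩ := hU (lam / (2 * v₁)) (by positivity)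
  -- the target scale `s < σ₀`, `s ≤ 1/8`
  set s : ℝ := min σ₀ (1 / 4) / 2 with hs
  have hs0 : 0 < s := by positivity
  have hsσ₀ : s < σ₀ := by have := min_le_left σ₀ (1 / 4); rw [hs]; linarith
  have hs8 : s ≤ 1 / 8 := by have := min_le_right σ₀ (1 / 4); rw [hs]; linarith
  -- the peak, the profile, the reduced diameter
  obtain ⟨ε, hε0, hε4, hKM⟩ := exists_peak_M_ge (lam / (v₁ * s ^ 3))
  have ha : Torus.IsSmooth (peak ε) := isSmooth_peak hε0 hε4
  have ha0 : ∀ x, 0 < peak ε x := peak_pos hε0.le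
  set P := profileOf (peak ε) ha.continuous ha0 with hP
  have hM0 : 0 < P.M := P.M_pos
  obtain ⟨σ, hσ, hσs, hMvσ⟩ := exists_sigma (M := P.M) hlam0 hv hM0 hs0 hKM
  have hσσ₀ : σ < σ₀ := hσs.trans_lt hsσ₀
  have hσ2 : σ < 1 / 2 := by linarith
  obtain ⟨hsmall, h16⟩ := numerics hM0 hlam0.le hMvσ hlam1
  have hPs : SmallDensity P σ :=
    UniformLGC.smallDensity_of_eta_le (Mstar := 2 * P.M) hσ hσ2 (by linarith) hsmall
  -- statics: `|rhoLim - β| ≤ M/4`; the activity maximum `x₀` has `β x₀ = M`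
  have hdev : ∀ x, |rhoLim P σ x - P.β x| ≤ P.M / 4 := fun x =>
    (PolynomialCompressionStatics.abs_rhoLim_sub_β_le hPs x).trans h16
  obtain ⟨x₀, -, hx₀⟩ := isCompact_univ.exists_isMaxOn univ_nonempty P.continuous.continuousOn
  have hβx₀ : P.M ≤ P.β x₀ :=
    csSup_le (range_nonempty _) (by rintro _ ⟨y, rfl⟩; exact (isMaxOn_iff.mp hx₀) y (mem_univ y))
  have hMσ : P.M * σ ^ 3 = lam / v₁ := by
    rw [← hMvσ]
    field_simp
  -- pinned packing: `≥ 3λ*/(4v₁) ≥ η*` at `x₀`, `≤ 5λ*/(4v₁) ≤ η₁` everywhere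
  have hpack_low : lam / (2 * v₁) ≤ rhoLim P σ x₀ * σ ^ 3 := by
    have h := (abs_le.1 (hdev x₀)).1
    have h1 : 3 / 4 * P.M ≤ rhoLim P σ x₀ := by linarith
    have hlv : 0 ≤ lam / v₁ := by positivity
    calc lam / (2 * v₁) = 1 / 2 * (lam / v₁) := by ring
      _ ≤ 3 / 4 * (lam / v₁) := by nlinarith
      _ = 3 / 4 * P.M * σ ^ 3 := by rw [← hMσ]; ring
      _ ≤ rhoLim P σ x₀ * σ ^ 3 := mul_le_mul_of_nonneg_right h1 (pow_pos hσ 3).le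
  have hpack_up : ∀ x, rhoLim P σ x * σ ^ 3 ≤ η₁ := by
    intro x
    have h := (abs_le.1 (hdev x)).2
    have hβ := P.le_M x
    have h1 : rhoLim P σ x ≤ 5 / 4 * P.M := by linarith
    have h2 : lam / v₁ ≤ 4 / 5 * η₁ := by
      rw [div_le_iff₀ hv]
      linarith
    calc rhoLim P σ x * σ ^ 3 ≤ 5 / 4 * P.M * σ ^ 3 := mul_le_mul_of_nonneg_right h1 (pow_pos hσ 3).le
      _ = 5 / 4 * (lam / v₁) := by rw [← hMσ]; ring
      _ ≤ η₁ := by linarith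
  -- an admissible classical solution from the pinned data, tied through every flow family
  obtain ⟨T, hT, ρ, θ, u, hE, hρ0, -, -, ⟨Φ⟩, htie⟩ :=
    ADM ha (Torus.isSmooth_const (1 : ℝ)) (Torus.isSmooth_const (0 : V3)) ha0 (fun _ => one_pos) hσ hσ2
      hsmall hpack_up
  -- the uniform bound fails at `t = 0`, `x = x₀`
  have hlt := D (peak ε) (fun _ => 1) (fun _ => 0) ha.continuous continuous_const continuous_const ha0
    (fun _ => one_pos) σ hσ hσσ₀ T ρ θ u hE Φ (htie Φ) 0 ⟨le_rfl, hT⟩ x₀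
  rw [hρ0] at hlt
  exact absurd hlt (not_lt.2 hpack_low)

end Summit.AtomisticToContinuum.HydrodynamicLimit.Theorems

end
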